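import Summits.BirchSwinnertonDyer.Rank1Residual.WAll.AltClosersCMTwoRamifiedFamilies
import Summits.BirchSwinnertonDyer.Rank1Residual.WAll.TargetCMTwoRamifiedOffTYZProved
import Literature.NumberTheory.EllipticCurves.Tian2014.CMPointSystemGenusBridge
import HarnessLib

/-!
# Route `PrintCf2` (cell `bsd-print-cf2`, D-0131 (2) PRINT TIER), item stmt-BirchSwinnertonDyer-20362
# `RamifiedTwoRankOneOfFacts` — the p1 slice IN THE ROUTE'S LANDING GRAMMAR and the glue of the LAYER-2 split
# «ON / OFF the proved Tian–Yuan–Zhang families» (PLAN.md v1 §2 p1)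

HONEST FRAMING (cell `bsd-print-cf2`, run/shared/lean/pub/bsd-print-cf2/): the deciding crux of the route,
`RamifiedTwoRankOneOfFacts` = 𝔅_ram → ∀ W (CM, `r_an = 1`, `2 ∣ d_K`), `BSD(E,2)`, is OPEN (no theorem in print
decides the ramified slice). This file does NOT import the route file (bsd-wall T8/T9: theorems over ITEM decl
names die at the next restate; glue lives over the statements' TEXT) and asserts nothing: every fact is an
antecedent. It (§1) proves the p1 SLICE of the crux in the route's landing grammar — the bundle 𝔅_ram (spelled
VERBATIM as the item's antecedent) ⟹ `BSD(E,2)` for every globally minimal CM curve of analytic rank one with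
`2` ramified that is a `ℚ`-model of a member of the FLAG-FREE TYZ families `CongruentTYZProvedFamily` (LLT ∨
T5 ∨ T7 ∨ M35 ∨ TYZρ; `WAll/TargetCMTwoRamifiedFamilies.lean`, p533515), by the closer
`PrintCf2.wAllCornerFTwoRamifiedTYZProved_of_facts` (p535702: binders TYZ17 Thm 1.2 AS PRINTED, Tian14 Thm 1.3,
Rédei–Reichardt, LLT24 Thm 1.2, Monsky90 Cor 5.15 (2), GZK — all conjuncts of 𝔅_ram; model transport fact-free,
ty2 p534422); and (§2) the GLUE the planner's `route edit --split RamifiedTwoRankOneOfFacts --into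
RamifiedTYZFamiliesOfFacts RamifiedOffTYZOfFacts` needs, over the statements' text:
(𝔅_ram → TYZProved-slice) → (𝔅_ram → `WAllCornerFTwoRamifiedOffTYZProved`) → (𝔅_ram → ramified slice), pure
logic (`wAllCornerFTwoRamified_of_tyzProved_of_offTYZProved`, p536500). Cell referee pre-verdict 12:49:43Z on the
slice: LLT, T5 PASS (beyond print NO); T7, M35, TYZρ PASS PROVED-by-name (beyond print YES). The U⁺-road
families (T6, TYZ-U⁺, A37; binder `tyz_genusPointData`, not in 𝔅_ram) and the FJ atlas (binder HB94 Monsky ODD,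
not in 𝔅_ram) are attacked sub-slices of the residual `WAllCornerFTwoRamifiedOffTYZProved`; they wait for the
planner's `…OfFactsPlus` twin (TURNKEY on HOME/STATUS).

References: route file `Summits/BirchSwinnertonDyer/BirchSwinnertonDyer/Theses/PrintCf2.lean` (item 20362, bundle
𝔅_ram), HOME/PLAN.md v1 §2; `WAll/TargetCMTwoRamifiedFamilies.lean`, `WAll/TargetCMTwoRamifiedOffTYZProved.lean`,
`WAll/AltClosersCMTwoRamifiedFamilies.lean`. [cite: TianYuanZhang2017, Thm. 1.2] [cite: Tian2014, Thm. 1.3]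
[cite: LiLiuTian2024, Thm. 1.2] [cite: Monsky1990MockHeegner, Cor. 5.15 (2)] [cite: Miller2011LMS, Def. 1.1].
-/

noncomputable section

open scoped Classical

open WeierstrassCurve Literature.NumberTheory.EllipticCurves
  Literature.NumberTheory.EllipticCurves.Rank1Residual
open Summit.BirchSwinnertonDyer Summit.BirchSwinnertonDyer.Rank1Residual.WAll

set_option autoImplicit false

namespace Summit.BirchSwinnertonDyer.PrintCf2

/-! ## §1 The p1 slice of crux 20362 in the route's landing grammar (bundle 𝔅_ram VERBATIM as antecedent) -/

/-- **REGISTERED STUB `stub_ramified_onTYZProvedFamilies` of item 20362 — the flag-free TYZ families slice of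
`RamifiedTwoRankOneOfFacts`** (signature verbatim as registered). Granted the item's bundle 𝔅_ram (its
eleven conjuncts verbatim: GZK, modularity, Cassels, CM rank-0 BSD, TYZ17 Thm 1.2 AS PRINTED, Tian14 Thm 1.3,
Rédei–Reichardt, LLT24 Thm 1.2, Monsky90 Cor 5.15 (2), HB94 Monsky (even), Tian's 𝒮⁻ system — of which only
conjuncts 1, 5, 6, 7, 8, 9 are used): every globally minimal CM curve of analytic rank one with `2` ramified in
the CM field that is a `ℚ`-model of a member of `CongruentTYZProvedFamily` (LLT ∨ T5 ∨ T7 ∨ M35 ∨ TYZρ)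
satisfies `BSD(E, 2)`. Beyond print: LLT, T5 NO; T7, M35, TYZρ YES (kernel assemblies of printed inputs).
[cite: TianYuanZhang2017, Thm. 1.2 (arXiv:1411.4728 §1)] [cite: Tian2014, Thm. 1.3 and Lemma 5.1]
[cite: LiLiuTian2024, Thm. 1.2] [cite: Monsky1990MockHeegner, Cor. 5.15 (2) (p. 66)] [cite: Miller2011LMS, Def. 1.1] -/
theorem stub_ramified_onTYZProvedFamilies : (Literature.NumberTheory.EllipticCurves.rank_eq_analyticRank_of_analyticRank_le_one ∧ WeierstrassCurve.hasEntireLFunction_rat ∧ WeierstrassCurve.bsdRHS_eq_of_isIsogenous ∧ Literature.NumberTheory.EllipticCurves.bsdTriple_of_hasCM_of_L_one_ne_zero ∧ Literature.NumberTheory.EllipticCurves.TianYuanZhang2017.thm12_parity_of_scriptL' ∧ Literature.NumberTheory.EllipticCurves.Tian2014.thm13_rank_one_and_sha_odd ∧ Literature.NumberTheory.QuadraticFields.RedeiReichardt.redeiReichardt_fourTwoCard_classGroup ∧ Literature.NumberTheory.EllipticCurves.LiLiuTian2024.thm12_bsd_congruentNumberCurve ∧ Literature.NumberTheory.EllipticCurves.Monsky1990.cor515_rank_eq_one_and_card_selmerGroup_two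 ∧ Literature.NumberTheory.EllipticCurves.HeathBrown1994.monsky_card_selmerGroup_two_even ∧ Literature.NumberTheory.EllipticCurves.Tian2014.tian2014_system_sMinus_genus) → ∀ (W : WeierstrassCurve ℚ) [W.IsElliptic] [W.IsGloballyMinimal], W.HasCM → W.analyticRank = 1 → Literature.NumberTheory.EllipticCurves.Rank1Residual.CMRamified W 2 → Summit.BirchSwinnertonDyer.CongruentTYZProvedFamily W → Literature.NumberTheory.EllipticCurves.BSDp W 2 :=
  fun hB ↦ Rank1Residual.WAll.PrintCf2.wAllCornerFTwoRamifiedTYZProved_of_facts hB.2.2.2.2.1 hB.2.2.2.2.2.1 hB.2.2.2.2.2.2.1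
    hB.2.2.2.2.2.2.2.1 hB.2.2.2.2.2.2.2.2.1 hB.1

/-- The same slice stated on the leaf NAME: 𝔅_ram ⟹ `WAllCornerFTwoRamifiedTYZProved` (definitionally the
statement above). [folklore] -/
theorem wAllCornerFTwoRamifiedTYZProved_of_bundle :
    (Literature.NumberTheory.EllipticCurves.rank_eq_analyticRank_of_analyticRank_le_one ∧
      WeierstrassCurve.hasEntireLFunction_rat ∧ WeierstrassCurve.bsdRHS_eq_of_isIsogenous ∧
      Literature.NumberTheory.EllipticCurves.bsdTriple_of_hasCM_of_L_one_ne_zero ∧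
      Literature.NumberTheory.EllipticCurves.TianYuanZhang2017.thm12_parity_of_scriptL' ∧
      Literature.NumberTheory.EllipticCurves.Tian2014.thm13_rank_one_and_sha_odd ∧
      Literature.NumberTheory.QuadraticFields.RedeiReichardt.redeiReichardt_fourTwoCard_classGroup ∧
      Literature.NumberTheory.EllipticCurves.LiLiuTian2024.thm12_bsd_congruentNumberCurve ∧
      Literature.NumberTheory.EllipticCurves.Monsky1990.cor515_rank_eq_one_and_card_selmerGroup_two ∧
      Literature.NumberTheory.EllipticCurves.HeathBrown1994.monsky_card_selmerGroup_two_even ∧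
      Literature.NumberTheory.EllipticCurves.Tian2014.tian2014_system_sMinus_genus) →
    WAllCornerFTwoRamifiedTYZProved :=
  stub_ramified_onTYZProvedFamilies

/-! ## §2 Glue for the LAYER-2 split of 20362 (over statement TEXT; no route decl named) -/

/-- **GLUE: (𝔅 → slice ON the proved TYZ families) → (𝔅 → slice OFF them) → (𝔅 → the whole ramified
slice)**, for ANY antecedent `𝔅` — instantiate with 𝔅_ram: this is the `--glue-by` theorem of the split
`RamifiedTwoRankOneOfFacts ⇐ RamifiedTYZFamiliesOfFacts ∧ RamifiedOffTYZOfFacts` (item bodies are these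
implications with 𝔅 = 𝔅_ram). Excluded middle on membership (`wAllCornerFTwoRamified_of_tyzProved_of_offTYZProved`).
[folklore] -/
theorem ramified_of_onTYZProved_of_offTYZProved {𝔅 : Prop}
    (hP : 𝔅 → WAllCornerFTwoRamifiedTYZProved) (hO : 𝔅 → WAllCornerFTwoRamifiedOffTYZProved) :
    𝔅 → ∀ (W : WeierstrassCurve ℚ) [W.IsElliptic] [W.IsGloballyMinimal], W.HasCM → W.analyticRank = 1 →
      CMRamified W 2 → BSDp W 2 :=
  fun hB ↦ wAllCornerFTwoRamified_of_tyzProved_of_offTYZProved (hP hB) (hO hB)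

/-- **Crux 20362 REDUCES to its flag-free residual**: granted 𝔅_ram, the ramified slice follows from
`WAllCornerFTwoRamifiedOffTYZProved` alone (the ON-part is §1). This is the statement of the split's residual
crux `RamifiedOffTYZOfFacts` ⟹ the parent, with the parent's body spelled verbatim. [folklore] -/
theorem ramifiedTwoRankOne_of_bundle_of_offTYZProved
    (hO : (Literature.NumberTheory.EllipticCurves.rank_eq_analyticRank_of_analyticRank_le_one ∧
      WeierstrassCurve.hasEntireLFunction_rat ∧ WeierstrassCurve.bsdRHS_eq_of_isIsogenous ∧
      Literature.NumberTheory.EllipticCurves.bsdTriple_of_hasCM_of_L_one_ne_zero ∧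
      Literature.NumberTheory.EllipticCurves.TianYuanZhang2017.thm12_parity_of_scriptL' ∧
      Literature.NumberTheory.EllipticCurves.Tian2014.thm13_rank_one_and_sha_odd ∧
      Literature.NumberTheory.QuadraticFields.RedeiReichardt.redeiReichardt_fourTwoCard_classGroup ∧
      Literature.NumberTheory.EllipticCurves.LiLiuTian2024.thm12_bsd_congruentNumberCurve ∧
      Literature.NumberTheory.EllipticCurves.Monsky1990.cor515_rank_eq_one_and_card_selmerGroup_two ∧
      Literature.NumberTheory.EllipticCurves.HeathBrown1994.monsky_card_selmerGroup_two_even ∧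
      Literature.NumberTheory.EllipticCurves.Tian2014.tian2014_system_sMinus_genus) →
      WAllCornerFTwoRamifiedOffTYZProved) :
    (Literature.NumberTheory.EllipticCurves.rank_eq_analyticRank_of_analyticRank_le_one ∧
      WeierstrassCurve.hasEntireLFunction_rat ∧ WeierstrassCurve.bsdRHS_eq_of_isIsogenous ∧
      Literature.NumberTheory.EllipticCurves.bsdTriple_of_hasCM_of_L_one_ne_zero ∧
      Literature.NumberTheory.EllipticCurves.TianYuanZhang2017.thm12_parity_of_scriptL' ∧
      Literature.NumberTheory.EllipticCurves.Tian2014.thm13_rank_one_and_sha_odd ∧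
      Literature.NumberTheory.QuadraticFields.RedeiReichardt.redeiReichardt_fourTwoCard_classGroup ∧
      Literature.NumberTheory.EllipticCurves.LiLiuTian2024.thm12_bsd_congruentNumberCurve ∧
      Literature.NumberTheory.EllipticCurves.Monsky1990.cor515_rank_eq_one_and_card_selmerGroup_two ∧
      Literature.NumberTheory.EllipticCurves.HeathBrown1994.monsky_card_selmerGroup_two_even ∧
      Literature.NumberTheory.EllipticCurves.Tian2014.tian2014_system_sMinus_genus) →
    ∀ (W : WeierstrassCurve ℚ) [W.IsElliptic] [W.IsGloballyMinimal], W.HasCM → W.analyticRank = 1 →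
      CMRamified W 2 → BSDp W 2 :=
  ramified_of_onTYZProved_of_offTYZProved wAllCornerFTwoRamifiedTYZProved_of_bundle hO

/-- **And conversely** the crux's body restricts to the residual's body (so the split is EXACT modulo 𝔅_ram).
[folklore] -/
theorem offTYZProved_of_ramifiedTwoRankOne {𝔅 : Prop}
    (hR : 𝔅 → ∀ (W : WeierstrassCurve ℚ) [W.IsElliptic] [W.IsGloballyMinimal], W.HasCM → W.analyticRank = 1 →
      CMRamified W 2 → BSDp W 2) :
    𝔅 → WAllCornerFTwoRamifiedOffTYZProved :=
  fun hB ↦ wAllCornerFTwoRamifiedOffTYZProved_of_wAllCornerFTwoRamified (hR hB)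

end Summit.BirchSwinnertonDyer.PrintCf2

end
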